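import Literature.AlgebraicTopology.SingularHomology.ExcisionTheorem
import HarnessLib

/-!
# Exactness of the Mayer–Vietoris sequence: discharge of the named facts
`Literature.AlgebraicTopology.SingularHomology.mayerVietoris.exact₁`, `Literature.AlgebraicTopology.SingularHomology.mayerVietoris.exact₂`, `Literature.AlgebraicTopology.SingularHomology.mayerVietoris.exact₃` and
`Literature.AlgebraicTopology.SingularHomology.mayerVietoris.δ_naturality`

`Literature.AlgebraicTopology.SingularHomology.ExcisionMayerVietoris` defines the Mayer–Vietoris
sequence of an open-interior cover `interior U ∪ interior V = X` for Mathlib's singular homology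
(A. Hatcher, *Algebraic Topology*, CUP 2002, §2.2, pp. 149–150),
`⋯ ⟶ Hₙ(U ∩ V) ⟶φ Hₙ(U) ⊞ Hₙ(V) ⟶ψ Hₙ(X) ⟶δ Hₙ₋₁(U ∩ V) ⟶ ⋯`,
with honest `φ`, `ψ` and connecting map `δ := j_* ≫ (excision)⁻¹ ≫ ∂ ≫ (≅)` through the pair
`(U, U ∩ V) → (X, V)`, proves the three complex identities, and leaves the three exactness
statements `exact₁/₂/₃` and the naturality of `δ` as **named facts** (D-0014). Here all four are
**proved** (`…_holds`), for every space, every cover and all coefficients.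

Since `δ` is *defined* through the long exact sequences of the pairs `(X, V)` and `(U, U ∩ V)` and
the excision isomorphism `Hₙ(U, U ∩ V) ≅ Hₙ(X, V)`, exactness is the classical derivation of the
Mayer–Vietoris sequence from the axioms (Eilenberg–Steenrod 1952, §I.15; cf. Hatcher 2002, §2.2
p. 150 and §2.3): three short diagram chases using only

* the long exact sequences of the two pairs and the naturality of `j_*` and `∂` under the map of
  pairs `(U, U ∩ V) → (X, V)` — all **proved** in
  `Literature.AlgebraicTopology.SingularHomology.RelativeHomology`
  (`exact_map_ofAbsolute`, `exact_ofAbsolute_δ`, `exact_δ_map`, `ofAbsolute_comp_map`,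
  `δ_naturality`), and
* excision (Hatcher Thm. 2.20), **proved** in
  `Literature.AlgebraicTopology.SingularHomology.ExcisionTheorem`
  (`relativeSingularHomology.isIso_map_of_interior_union_interior_holds`); `exact₂`, `exact₃` and
  `δ_naturality` take excision as an explicit hypothesis `hexc` (it enters the definition of `δ`),
  `exact₁` does not, and there we use the proved theorem.

No chain-level argument is needed. Contents:

* element-level lemmas on binary biproducts in `ModuleCat` (`biprod_apply_decomp`,
  `biprod_apply_ext`, evaluation of `biprod.lift`/`biprod.desc`);
* `mayerVietoris.δ_apply` (the connecting map on an element) and the two inclusions of `U ∩ V`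
  rewritten through the homeomorphism `U ↓∩ V ≃ₜ U ∩ V`;
* `mayerVietoris.exact₁_holds`, `exact₂_holds`, `exact₃_holds`, `δ_naturality_holds`.

## References

* A. Hatcher, *Algebraic Topology*, CUP 2002, §2.1 (long exact sequence of the pair, Thm. 2.16
  ff., Thm. 2.20), §2.2 pp. 149–150 (Mayer–Vietoris) [HatcherAT2002].
* S. Eilenberg, N. Steenrod, *Foundations of Algebraic Topology*, Princeton 1952, §I.15
  (Mayer–Vietoris from the axioms) [folklore derivation; not cited in the statements].
-/

noncomputable section

open CategoryTheory Limits Set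

universe u v

namespace Literature.AlgebraicTopology.SingularHomology

variable (R : Type v) [CommRing R] (M : Type v) [AddCommGroup M] [Module R M]

/-! ### Elements of binary biproducts of modules -/

section Biprod

variable {R}
variable {P Q T : ModuleCat.{u} R}

/-- `y = inl (fst y) + inr (snd y)` for an element of a binary biproduct of modules
(`biprod.total`). [folklore] -/
lemma biprod_apply_decomp (y : ↑(P ⊞ Q)) :
    (biprod.inl : P ⟶ P ⊞ Q) ((biprod.fst : P ⊞ Q ⟶ P) y) +
      (biprod.inr : Q ⟶ P ⊞ Q) ((biprod.snd : P ⊞ Q ⟶ Q) y) = y := by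
  have htot := congrArg (fun φ : P ⊞ Q ⟶ P ⊞ Q => φ y) (biprod.total : _ = 𝟙 (P ⊞ Q))
  simpa only [ModuleCat.hom_add, LinearMap.add_apply, ModuleCat.comp_apply,
    ModuleCat.id_apply] using htot

/-- Two elements of a binary biproduct of modules with the same projections are equal. [folklore] -/
lemma biprod_apply_ext {y y' : ↑(P ⊞ Q)}
    (h₁ : (biprod.fst : P ⊞ Q ⟶ P) y = (biprod.fst : P ⊞ Q ⟶ P) y')
    (h₂ : (biprod.snd : P ⊞ Q ⟶ Q) y = (biprod.snd : P ⊞ Q ⟶ Q) y') : y = y' := by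
  rw [← biprod_apply_decomp y, ← biprod_apply_decomp y', h₁, h₂]

/-- `fst (lift f g x) = f x`. [folklore] -/
lemma biprod_fst_lift_apply (f : T ⟶ P) (g : T ⟶ Q) (x : T) :
    (biprod.fst : P ⊞ Q ⟶ P) ((biprod.lift f g) x) = f x := by
  rw [← ModuleCat.comp_apply, biprod.lift_fst]

/-- `snd (lift f g x) = g x`. [folklore] -/
lemma biprod_snd_lift_apply (f : T ⟶ P) (g : T ⟶ Q) (x : T) :
    (biprod.snd : P ⊞ Q ⟶ Q) ((biprod.lift f g) x) = g x := by
  rw [← ModuleCat.comp_apply, biprod.lift_snd]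

/-- `desc f g (inl a) = f a`. [folklore] -/
lemma biprod_desc_inl_apply (f : P ⟶ T) (g : Q ⟶ T) (a : P) :
    (biprod.desc f g) ((biprod.inl : P ⟶ P ⊞ Q) a) = f a := by
  rw [← ModuleCat.comp_apply, biprod.inl_desc]

/-- `desc f g (inr b) = g b`. [folklore] -/
lemma biprod_desc_inr_apply (f : P ⟶ T) (g : Q ⟶ T) (b : Q) :
    (biprod.desc f g) ((biprod.inr : Q ⟶ P ⊞ Q) b) = g b := by
  rw [← ModuleCat.comp_apply, biprod.inr_desc]

/-- `desc f g y = f (fst y) + g (snd y)`. [folklore] -/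
lemma biprod_desc_apply (f : P ⟶ T) (g : Q ⟶ T) (y : ↑(P ⊞ Q)) :
    (biprod.desc f g) y =
      f ((biprod.fst : P ⊞ Q ⟶ P) y) + g ((biprod.snd : P ⊞ Q ⟶ Q) y) := by
  conv_lhs => rw [← biprod_apply_decomp y]
  rw [map_add, biprod_desc_inl_apply, biprod_desc_inr_apply]

end Biprod

/-! ### The Mayer–Vietoris sequence: exactness -/

namespace mayerVietoris

variable {X Y : Type u} [TopologicalSpace X] [TopologicalSpace Y]
variable (U V : Set X)

/-- The inclusion `U ↓∩ V ↪ U` is the inclusion `U ∩ V ↪ U` precomposed with the homeomorphism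
`U ↓∩ V ≃ₜ U ∩ V`. [folklore] -/
lemma subsetInclusion_left_comp_preimageValHomeomorph :
    (subsetInclusion (Set.inter_subset_left : U ∩ V ⊆ U)).comp
      (preimageValHomeomorph U V : C(↥(Subtype.val ⁻¹' V : Set U), ↥(U ∩ V))) =
      subsetIncl (Subtype.val ⁻¹' V : Set U) := by
  ext x; rfl

/-- The inclusion `U ↓∩ V → V` (second component of the map of pairs `(U, U ↓∩ V) → (X, V)`) is
the inclusion `U ∩ V ↪ V` precomposed with the homeomorphism `U ↓∩ V ≃ₜ U ∩ V`. [folklore] -/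
lemma subsetInclusion_right_comp_preimageValHomeomorph :
    (subsetInclusion (Set.inter_subset_right : U ∩ V ⊆ V)).comp
      (preimageValHomeomorph U V : C(↥(Subtype.val ⁻¹' V : Set U), ↥(U ∩ V))) =
      subsetRestrict (subsetIncl U) (Set.mapsTo_preimage Subtype.val V) := by
  ext x; rfl

/-- The composite of the two components `(U, U ↓∩ V) → (X, V)`: `U ↓∩ V → V ↪ X` equals
`U ↓∩ V ↪ U ↪ X`. [folklore] -/
lemma subsetIncl_comp_subsetRestrict :
    (subsetIncl V).comp (subsetRestrict (subsetIncl U) (Set.mapsTo_preimage Subtype.val V)) =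
      (subsetIncl U).comp (subsetIncl (Subtype.val ⁻¹' V : Set U)) := by
  ext x; rfl

/-- **The connecting map on an element**: `δ x = e_* (∂ (exc⁻¹ (j_* x)))` with `e` the
homeomorphism `U ↓∩ V ≃ₜ U ∩ V` (Hatcher 2002, §2.2, pp. 149–150: on a cycle `z = x + y`,
`δ [z] = [∂ x]`). [cite: HatcherAT2002, §2.2 pp. 149–150] -/
lemma δ_apply (hexc : relativeSingularHomology.isIso_map_of_interior_union_interior R M X)
    (h : interior U ∪ interior V = Set.univ) (n : ℕ) (x : singularHomology R M X (n + 1)) :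
    δ R M U V hexc h n x =
      haveI := isIso_excisionMap R M U V hexc h (n + 1)
      singularHomology.map R M
          (preimageValHomeomorph U V : C(↥(Subtype.val ⁻¹' V : Set U), ↥(U ∩ V))) n
        (relativeSingularHomology.δ R M U (Subtype.val ⁻¹' V) n
          (inv (excisionMap R M U V (n + 1))
            (relativeSingularHomology.ofAbsolute R M X V (n + 1) x))) := by
  rfl

variable {U V}

/-- **Discharge of the named fact `Literature.AlgebraicTopology.SingularHomology.mayerVietoris.exact₂`**: exactness of the Mayer–Vietoris
sequence at `Hₙ₊₁(X)`, `Hₙ₊₁(U) ⊞ Hₙ₊₁(V) ⟶ψ Hₙ₊₁(X) ⟶δ Hₙ(U ∩ V)` (Hatcher 2002, §2.2, p. 149).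
Chase: if `δ x = 0` then `exc⁻¹ (j_* x) = j_* a` for some `a ∈ Hₙ₊₁(U)` (exactness of the pair
`(U, U ∩ V)` at `Hₙ₊₁(U, U ∩ V)`), so `j_* (x - i_{U*} a) = 0` (naturality of `j_*`) and
`x - i_{U*} a = i_{V*} b` (exactness of `(X, V)` at `Hₙ₊₁(X)`). [cite: HatcherAT2002, §2.2 p. 149] -/
theorem exact₂_holds (U V : Set X) : exact₂ R M U V := by
  intro hexc h n
  haveI := isIso_excisionMap R M U V hexc h (n + 1)
  rw [ShortComplex.moduleCat_exact_iff]
  intro x hx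
  change δ R M U V hexc h n x = 0 at hx
  rw [δ_apply] at hx
  -- `∂ (exc⁻¹ (j x)) = 0` since the homeomorphism is injective on homology
  have h1 : relativeSingularHomology.δ R M U (Subtype.val ⁻¹' V) n
      (inv (excisionMap R M U V (n + 1)) (relativeSingularHomology.ofAbsolute R M X V (n + 1) x)) = 0 := by
    have e := congrArg (singularHomology.mapIso R M (preimageValHomeomorph U V) n).inv hx
    rw [map_zero] at e
    rw [← e]
    change _ = ((singularHomology.mapIso R M (preimageValHomeomorph U V) n).hom ≫
      (singularHomology.mapIso R M (preimageValHomeomorph U V) n).inv) _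
    rw [Iso.hom_inv_id, ModuleCat.id_apply]
  -- exactness of `(U, U ↓∩ V)` at `Hₙ₊₁(U, U ↓∩ V)`
  obtain ⟨a, ha⟩ := (ShortComplex.moduleCat_exact_iff _).mp
    (relativeSingularHomology.exact_ofAbsolute_δ R M (X := ↥U) (Subtype.val ⁻¹' V) n) _ h1
  change relativeSingularHomology.ofAbsolute R M (↥U) (Subtype.val ⁻¹' V) (n + 1) a = _ at ha
  -- apply the excision isomorphism and naturality of `j_*`
  have h2 : relativeSingularHomology.ofAbsolute R M X V (n + 1)
      (x - singularHomology.map R M (subsetIncl U) (n + 1) a) = 0 := by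
    have e := congrArg (excisionMap R M U V (n + 1)) ha
    rw [← ModuleCat.comp_apply (inv (excisionMap R M U V (n + 1))) (excisionMap R M U V (n + 1)),
      IsIso.inv_hom_id, ModuleCat.id_apply, ← ModuleCat.comp_apply, excisionMap,
      relativeSingularHomology.ofAbsolute_comp_map, ModuleCat.comp_apply] at e
    rw [map_sub, ← e, sub_self]
  -- exactness of `(X, V)` at `Hₙ₊₁(X)`
  obtain ⟨b, hb⟩ := (ShortComplex.moduleCat_exact_iff _).mp
    (relativeSingularHomology.exact_map_ofAbsolute R M (X := X) V (n + 1)) _ h2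
  change singularHomology.map R M (subsetIncl V) (n + 1) b = _ at hb
  refine ⟨(biprod.inl : singularHomology R M U (n + 1) ⟶
      singularHomology R M U (n + 1) ⊞ singularHomology R M V (n + 1)) a +
    (biprod.inr : singularHomology R M V (n + 1) ⟶
      singularHomology R M U (n + 1) ⊞ singularHomology R M V (n + 1)) b, ?_⟩
  change ψ R M U V (n + 1) _ = x
  rw [map_add, ψ, biprod_desc_inl_apply, biprod_desc_inr_apply, hb, add_sub_cancel]

/-- **Discharge of the named fact `Literature.AlgebraicTopology.SingularHomology.mayerVietoris.exact₃`**: exactness of the Mayer–Vietoris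
sequence at `Hₙ(U ∩ V)`, `Hₙ₊₁(X) ⟶δ Hₙ(U ∩ V) ⟶φ Hₙ(U) ⊞ Hₙ(V)` (Hatcher 2002, §2.2, p. 149).
Chase: if `c ↦ 0` in `Hₙ(U)` then `c = ∂ w` for some `w ∈ Hₙ₊₁(U, U ∩ V)` (exactness of
`(U, U ∩ V)` at `Hₙ(U ∩ V)`); the excised class `exc w ∈ Hₙ₊₁(X, V)` has
`∂ (exc w) = (c ↦ Hₙ(V)) = 0` (naturality of `∂`), so `exc w = j_* x` (exactness of `(X, V)` at
`Hₙ₊₁(X, V)`), and `δ x = c`. [cite: HatcherAT2002, §2.2 p. 149] -/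
theorem exact₃_holds (U V : Set X) : exact₃ R M U V := by
  intro hexc h n
  haveI := isIso_excisionMap R M U V hexc h (n + 1)
  rw [ShortComplex.moduleCat_exact_iff]
  intro c hc
  change φ R M U V n c = 0 at hc
  have hcU : singularHomology.map R M (subsetInclusion (Set.inter_subset_left : U ∩ V ⊆ U)) n c = 0 := by
    have e := congrArg
      (biprod.fst : singularHomology R M U n ⊞ singularHomology R M V n ⟶ singularHomology R M U n) hc
    rwa [φ, biprod_fst_lift_apply, map_zero] at e
  have hcV : singularHomology.map R M (subsetInclusion (Set.inter_subset_right : U ∩ V ⊆ V)) n c = 0 := by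
    have e := congrArg
      (biprod.snd : singularHomology R M U n ⊞ singularHomology R M V n ⟶ singularHomology R M V n) hc
    rw [φ, biprod_snd_lift_apply, map_zero] at e
    change -(singularHomology.map R M (subsetInclusion _) n c) = 0 at e
    exact neg_eq_zero.mp e
  -- transport `c` to `Hₙ(U ↓∩ V)`
  set eUV := singularHomology.mapIso R M (preimageValHomeomorph U V) n with heUV
  set c' : singularHomology R M ↥(Subtype.val ⁻¹' V : Set U) n := eUV.inv c with hc'
  have hcc' : eUV.hom c' = c := by
    rw [hc', ← ModuleCat.comp_apply, Iso.inv_hom_id, ModuleCat.id_apply]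
  have hc'U : singularHomology.map R M (subsetIncl (Subtype.val ⁻¹' V : Set U)) n c' = 0 := by
    rw [← subsetInclusion_left_comp_preimageValHomeomorph, singularHomology.map_comp,
      ModuleCat.comp_apply]
    change singularHomology.map R M (subsetInclusion _) n (eUV.hom c') = 0
    rw [hcc', hcU]
  have hc'V : singularHomology.map R M
      (subsetRestrict (subsetIncl U) (Set.mapsTo_preimage Subtype.val V)) n c' = 0 := by
    rw [← subsetInclusion_right_comp_preimageValHomeomorph, singularHomology.map_comp,
      ModuleCat.comp_apply]
    change singularHomology.map R M (subsetInclusion _) n (eUV.hom c') = 0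
    rw [hcc', hcV]
  -- exactness of `(U, U ↓∩ V)` at `Hₙ(U ↓∩ V)`: `c' = ∂ w`
  obtain ⟨w, hw⟩ := (ShortComplex.moduleCat_exact_iff _).mp
    (relativeSingularHomology.exact_δ_map R M (X := ↥U) (Subtype.val ⁻¹' V) n) _ hc'U
  change relativeSingularHomology.δ R M (↥U) (Subtype.val ⁻¹' V) n w = c' at hw
  -- `∂ (exc w) = 0` in `Hₙ(V)` by naturality of `∂`
  have h3 : relativeSingularHomology.δ R M X V n (excisionMap R M U V (n + 1) w) = 0 := by
    rw [← ModuleCat.comp_apply, excisionMap, ← relativeSingularHomology.δ_naturality,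
      ModuleCat.comp_apply, hw, hc'V]
  -- exactness of `(X, V)` at `Hₙ₊₁(X, V)`: `exc w = j x`
  obtain ⟨x, hx⟩ := (ShortComplex.moduleCat_exact_iff _).mp
    (relativeSingularHomology.exact_ofAbsolute_δ R M (X := X) V n) _ h3
  change relativeSingularHomology.ofAbsolute R M X V (n + 1) x = _ at hx
  refine ⟨x, ?_⟩
  change δ R M U V hexc h n x = c
  rw [δ_apply, hx, ← ModuleCat.comp_apply (excisionMap R M U V (n + 1)), IsIso.hom_inv_id,
    ModuleCat.id_apply, hw]
  exact hcc'

/-- **Discharge of the named fact `Literature.AlgebraicTopology.SingularHomology.mayerVietoris.exact₁`**: exactness of the Mayer–Vietoris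
sequence at `Hₙ(U) ⊞ Hₙ(V)`, `Hₙ(U ∩ V) ⟶φ Hₙ(U) ⊞ Hₙ(V) ⟶ψ Hₙ(X)` (Hatcher 2002, §2.2,
p. 149). Chase: if `i_{U*} a + i_{V*} b = 0` then `exc (j_* a) = j_* (i_{U*} a) = -j_* (i_{V*} b)
= 0`, so `j_* a = 0` (excision, Thm. 2.20, proved in `…ExcisionTheorem`) and `a = i_* c₀`,
`c₀ ∈ Hₙ(U ∩ V)`; then `i_{V*} (b + i_* c₀) = 0`, so `b + i_* c₀ = ∂ (exc w)` `= i_* (∂ w)` for some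
`w ∈ Hₙ₊₁(U, U ∩ V)` (exactness of `(X, V)`, excision, naturality of `∂`), and `c = c₀ - ∂ w`
satisfies `φ c = (a, b)`. [cite: HatcherAT2002, §2.2 p. 149] -/
theorem exact₁_holds (U V : Set X) : exact₁ R M U V := by
  intro h n
  have hexc := relativeSingularHomology.isIso_map_of_interior_union_interior_holds R M X
  haveI := isIso_excisionMap R M U V hexc h n
  haveI := isIso_excisionMap R M U V hexc h (n + 1)
  rw [ShortComplex.moduleCat_exact_iff]
  intro y hy
  change ψ R M U V n y = 0 at hy
  rw [ψ, biprod_desc_apply] at hy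
  set a := (biprod.fst : singularHomology R M U n ⊞ singularHomology R M V n ⟶
    singularHomology R M U n) y with ha
  set b := (biprod.snd : singularHomology R M U n ⊞ singularHomology R M V n ⟶
    singularHomology R M V n) y with hb
  clear_value a b
  -- `exc (j a) = j (i_U a) = - j (i_V b) = 0`, hence `j a = 0`
  have h1 : relativeSingularHomology.ofAbsolute R M (↥U) (Subtype.val ⁻¹' V) n a = 0 := by
    apply (ModuleCat.mono_iff_injective (excisionMap R M U V n)).mp inferInstance
    rw [map_zero, ← ModuleCat.comp_apply, excisionMap, relativeSingularHomology.ofAbsolute_comp_map,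
      ModuleCat.comp_apply, eq_neg_of_add_eq_zero_left hy, map_neg, ← ModuleCat.comp_apply,
      relativeSingularHomology.map_comp_ofAbsolute]
    simp
  -- exactness of `(U, U ↓∩ V)` at `Hₙ(U)`: `a = i c₀`
  obtain ⟨c₀, hc₀⟩ := (ShortComplex.moduleCat_exact_iff _).mp
    (relativeSingularHomology.exact_map_ofAbsolute R M (X := ↥U) (Subtype.val ⁻¹' V) n) _ h1
  change singularHomology.map R M (subsetIncl (Subtype.val ⁻¹' V : Set U)) n c₀ = a at hc₀
  -- `i_V (b + c₀|V) = 0`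
  have h2 : singularHomology.map R M (subsetIncl V) n
      (b + singularHomology.map R M
        (subsetRestrict (subsetIncl U) (Set.mapsTo_preimage Subtype.val V)) n c₀) = 0 := by
    rw [map_add, ← ModuleCat.comp_apply, ← singularHomology.map_comp,
      subsetIncl_comp_subsetRestrict, singularHomology.map_comp, ModuleCat.comp_apply, hc₀,
      add_comm, hy]
  -- exactness of `(X, V)` at `Hₙ(V)`: `b + c₀|V = ∂ yv`, and `yv = exc w`
  obtain ⟨yv, hyv⟩ := (ShortComplex.moduleCat_exact_iff _).mp
    (relativeSingularHomology.exact_δ_map R M (X := X) V n) _ h2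
  change relativeSingularHomology.δ R M X V n yv = _ at hyv
  set w := inv (excisionMap R M U V (n + 1)) yv with hw
  have hw' : excisionMap R M U V (n + 1) w = yv := by
    rw [hw, ← ModuleCat.comp_apply, IsIso.inv_hom_id, ModuleCat.id_apply]
  have h3 : singularHomology.map R M
      (subsetRestrict (subsetIncl U) (Set.mapsTo_preimage Subtype.val V)) n
        (relativeSingularHomology.δ R M (↥U) (Subtype.val ⁻¹' V) n w) =
      b + singularHomology.map R M
        (subsetRestrict (subsetIncl U) (Set.mapsTo_preimage Subtype.val V)) n c₀ := by
    rw [← ModuleCat.comp_apply, relativeSingularHomology.δ_naturality, ModuleCat.comp_apply]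
    change relativeSingularHomology.δ R M X V n (excisionMap R M U V (n + 1) w) = _
    rw [hw', hyv]
  -- the element `c = e (c₀ - ∂ w)`
  set c₁ := c₀ - relativeSingularHomology.δ R M (↥U) (Subtype.val ⁻¹' V) n w with hc₁
  refine ⟨singularHomology.map R M
    (preimageValHomeomorph U V : C(↥(Subtype.val ⁻¹' V : Set U), ↥(U ∩ V))) n c₁, ?_⟩
  change φ R M U V n _ = y
  refine biprod_apply_ext ?_ ?_
  · rw [φ, biprod_fst_lift_apply, ← ha, ← ModuleCat.comp_apply, ← singularHomology.map_comp,
      subsetInclusion_left_comp_preimageValHomeomorph, hc₁, map_sub, hc₀, ← ModuleCat.comp_apply,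
      relativeSingularHomology.δ_comp_map]
    simp
  · rw [φ, biprod_snd_lift_apply, ← hb]
    change -(singularHomology.map R M (subsetInclusion _) n
      (singularHomology.map R M (preimageValHomeomorph U V : C(_, ↥(U ∩ V))) n c₁)) = b
    rw [← ModuleCat.comp_apply, ← singularHomology.map_comp,
      subsetInclusion_right_comp_preimageValHomeomorph, hc₁, map_sub, h3]
    abel

/-- **Discharge of the named fact `Literature.AlgebraicTopology.SingularHomology.mayerVietoris.δ_naturality`**: for `f : X → Y` with
`f '' U ⊆ U'`, `f '' V ⊆ V'`, `(f|_{U ∩ V})_* ∘ δ = δ ∘ f_*` (Hatcher 2002, §2.2, p. 150). Each of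
the four constituents of `δ` is natural: `j_*` (`ofAbsolute_comp_map`), the excision isomorphism
(functoriality of the map of pairs), `∂` (`relativeSingularHomology.δ_naturality`) and the
homeomorphism `U ↓∩ V ≃ₜ U ∩ V`. [cite: HatcherAT2002, §2.2 p. 150] -/
theorem δ_naturality_holds : δ_naturality R M (X := X) (Y := Y) := by
  intro hexc hexc' U V U' V' f hU hV h h' n
  haveI := isIso_excisionMap R M U V hexc h (n + 1)
  haveI := isIso_excisionMap R M U' V' hexc' h' (n + 1)
  -- the restriction of `f` to `U → U'` as a map of pairs `(U, U ↓∩ V) → (U', U' ↓∩ V')`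
  have hfU : Set.MapsTo (subsetRestrict f hU) (Subtype.val ⁻¹' V : Set U) (Subtype.val ⁻¹' V') :=
    fun x hx => hV hx
  -- naturality of the excision maps: `exc ≫ f_* = (f|U)_* ≫ exc'`
  have hexcnat : excisionMap R M U V (n + 1) ≫ relativeSingularHomology.map R M f hV (n + 1) =
      relativeSingularHomology.map R M (subsetRestrict f hU) hfU (n + 1) ≫
        excisionMap R M U' V' (n + 1) := by
    rw [excisionMap, excisionMap, ← relativeSingularHomology.map_comp,
      ← relativeSingularHomology.map_comp]
    rfl
  have hinv : inv (excisionMap R M U V (n + 1)) ≫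
      relativeSingularHomology.map R M (subsetRestrict f hU) hfU (n + 1) =
      relativeSingularHomology.map R M f hV (n + 1) ≫ inv (excisionMap R M U' V' (n + 1)) := by
    rw [IsIso.inv_comp_eq, ← Category.assoc, hexcnat, Category.assoc, IsIso.hom_inv_id,
      Category.comp_id]
  -- naturality of the homeomorphisms
  have hhomeo : (subsetRestrict f (hU.inter_inter hV)).comp
      (preimageValHomeomorph U V : C(↥(Subtype.val ⁻¹' V : Set U), ↥(U ∩ V))) =
      (preimageValHomeomorph U' V' : C(↥(Subtype.val ⁻¹' V' : Set U'), ↥(U' ∩ V'))).comp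
        (subsetRestrict (subsetRestrict f hU) hfU) := by
    ext x
    rfl
  rw [δ, δ, Category.assoc, Category.assoc, Category.assoc, ← singularHomology.map_comp, hhomeo,
    singularHomology.map_comp, relativeSingularHomology.δ_naturality_assoc,
    ← relativeSingularHomology.ofAbsolute_comp_map_assoc]
  congr 1
  rw [← Category.assoc, hinv, Category.assoc]

end mayerVietoris

end Literature.AlgebraicTopology.SingularHomology
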